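/-
Copyright (c) 2026 the pub-hodgecm-mathlib formalisation cell (harness21).  Prover seat hodgecm-mathlib-F0P2-p11 (g0) (L1 re-deal s1969∕s1970, LEAD F0P6-plan (g14)
EMIT #1 «p22» (R1-α)), Track B «K2-LIT» ∕ hLiu418 #184♮, ROAD Φ, G5-b = Φ7-3, organ (R1-α): the bridge from the TOP's kind-1 condition `S ≠ 0 ∧ det S = 0` to the rank-one
presentation `S = u ⊗ w` used by ★ p861293 ∕ p861327 ∕ p861405.  THEOREMS ONLY.
-/
import Mathlib.LinearAlgebra.Matrix.Determinant.Basic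
import Mathlib.Data.Matrix.Mul
import Mathlib.LinearAlgebra.Matrix.Notation
import Mathlib.Tactic.Ring
import HarnessLib

/-!
# Crux `HLiu418`, ROAD Φ, organ Φ7-3 (R1-α): A NON-ZERO SINGULAR `2 × 2` MATRIX IS A RANK-ONE TENSOR `u ⊗ w` WITH `u ≠ 0`, `w ≠ 0`

Cell `hodgecm-mathlib`, crux item hLiu418 = `stmt-HodgeConjecture-24832` (helper lane, count-neutral); prover F0P2-p11 (g0).  THEOREMS ONLY (no `def`, no `instance`, no notation,
no named-fact hypothesis, no `sorry`).

WHY.  ★ #41 TOP edition 3 `K2LiuSiegelEisensteinContinuationTopKinds.siegelEisensteinContinuation_of_kinds` dispatches the Fourier indices by KIND; its rank-one kind is the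
condition `S ≠ 0 ∧ det S = 0` on a `T_L`-skew `2 × 2` index (binder `hcoef₁`), whereas the (R1-α) heads ★ p861327 `exists_middle_cell_rankOne_eq_corner_integral` and ★ p861405
`exists_whittakerDelta_rankOne_eq_corner_integral` (and ★ p861293 `corner_levi_iff_mk_eq`, ★ Φ7-1 (i) `exists_corner_supported_levi`) take the index in the form
`S = Matrix.vecMulVec u w` with `u ≠ 0`, `w ≠ 0`.  This file is the two-line bridge, over any field:
* `exists_vecMulVec_of_det_eq_zero` — `S ≠ 0`, `det S = 0` (`2 × 2`) ⇒ `∃ u w, u ≠ 0 ∧ w ≠ 0 ∧ S = u ⊗ w` (`w` = a non-zero row of `S`, `u` = the coefficients of the rows along it);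
* `vecMulVec_ne_zero`, `det_vecMulVec_fin_two` — the converse direction (`u ⊗ w ≠ 0` for `u, w ≠ 0`; `det (u ⊗ w) = 0`), so the two descriptions of the rank-one kind coincide.
References: [Shimura1997] §18.3 (singular Fourier coefficients are indexed by rank); [KudlaRallis1994] §2.
HONEST LABEL.  Count-neutral helper: `HC_CM` is proved only modulo the 7 printed citations (2 remaining named inputs: hLiu418 = `stmt-HodgeConjecture-24832`,
h413 = `stmt-HodgeConjecture-24833`) until rung 0 closes.
-/

set_option autoImplicit false
set_option linter.dupNamespace false -- the mandated namespace repeats `HodgeConjecture.HodgeConjecture`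

namespace Summit.HodgeConjecture.HodgeConjecture.Cruxes.HLiu418.K2LiuRankOneTwoByTwo

variable {K : Type*} [Field K]

/-- `u ⊗ w ≠ 0` for `u ≠ 0`, `w ≠ 0` (over a field; any index types). [folklore] -/
theorem vecMulVec_ne_zero {m n : Type*} {u : m → K} {w : n → K} (hu : u ≠ 0) (hw : w ≠ 0) : Matrix.vecMulVec u w ≠ 0 := by
  obtain ⟨i, hi⟩ := Function.ne_iff.1 hu
  obtain ⟨j, hj⟩ := Function.ne_iff.1 hw
  intro h
  have hij := congrFun (congrFun h i) j
  rw [Matrix.vecMulVec_apply, Matrix.zero_apply] at hij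
  exact (mul_ne_zero hi hj) hij

/-- `det (u ⊗ w) = 0` for `2 × 2` rank-one tensors. [folklore] -/
theorem det_vecMulVec_fin_two (u w : Fin 2 → K) : (Matrix.vecMulVec u w).det = 0 := by
  rw [Matrix.det_fin_two]
  simp only [Matrix.vecMulVec_apply]
  ring

/-- **A NON-ZERO SINGULAR `2 × 2` MATRIX IS A RANK-ONE TENSOR**: `S ≠ 0`, `det S = 0` ⇒ `S = u ⊗ w` with `u ≠ 0`, `w ≠ 0` (`w` a non-zero row of `S`). [folklore] -/
theorem exists_vecMulVec_of_det_eq_zero {S : Matrix (Fin 2) (Fin 2) K} (hS0 : S ≠ 0) (hdet : S.det = 0) :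
    ∃ u w : Fin 2 → K, u ≠ 0 ∧ w ≠ 0 ∧ S = Matrix.vecMulVec u w := by
  rw [Matrix.det_fin_two] at hdet
  by_cases h0 : S 0 = 0
  · -- the first row vanishes: `S = e₁ ⊗ S₁`, and `S₁ ≠ 0`
    have h1 : S 1 ≠ 0 := by
      intro h1
      apply hS0
      ext i j
      fin_cases i
      · exact congrFun h0 j
      · exact congrFun h1 j
    refine ⟨![0, 1], S 1, ?_, h1, ?_⟩
    · intro h
      have := congrFun h 1
      simp at this
    · ext i j
      fin_cases i
      · simpa [Matrix.vecMulVec_apply] using congrFun h0 j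
      · simp [Matrix.vecMulVec_apply]
  · -- the first row `w := S₀` is non-zero: the second row is `λ • w`
    by_cases h00 : S 0 0 = 0
    · -- then `S 0 1 ≠ 0`, `det = 0` forces `S 1 0 = 0`, and `λ = S 1 1 / S 0 1`
      have h01 : S 0 1 ≠ 0 := by
        intro h01
        apply h0
        funext j
        fin_cases j
        · exact h00
        · exact h01
      have h10 : S 1 0 = 0 := by
        have : S 0 1 * S 1 0 = 0 := by rw [h00, zero_mul, zero_sub, neg_eq_zero] at hdet; exact hdet
        exact (mul_eq_zero.1 this).resolve_left h01
      refine ⟨![1, S 1 1 / S 0 1], S 0, ?_, h0, ?_⟩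
      · intro h
        have := congrFun h 0
        simp at this
      · ext i j
        fin_cases i <;> fin_cases j
        · simp [Matrix.vecMulVec_apply]
        · simp [Matrix.vecMulVec_apply]
        · simp [Matrix.vecMulVec_apply, h00, h10]
        · simp [Matrix.vecMulVec_apply, div_mul_cancel₀ _ h01]
    · -- `S 0 0 ≠ 0`: `λ = S 1 0 / S 0 0`, and `det = 0` gives `S 1 1 = λ · S 0 1`
      refine ⟨![1, S 1 0 / S 0 0], S 0, ?_, h0, ?_⟩
      · intro h
        have := congrFun h 0
        simp at this
      · have h11 : S 1 1 = S 1 0 / S 0 0 * S 0 1 := by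
          rw [div_mul_eq_mul_div, eq_div_iff h00, mul_comm (S 1 1)]
          exact (sub_eq_zero.1 hdet).trans (mul_comm _ _)
        ext i j
        fin_cases i <;> fin_cases j
        · simp [Matrix.vecMulVec_apply]
        · simp [Matrix.vecMulVec_apply]
        · simp [Matrix.vecMulVec_apply, div_mul_cancel₀ _ h00]
        · simpa [Matrix.vecMulVec_apply] using h11

/-- **THE TWO DESCRIPTIONS OF THE RANK-ONE KIND COINCIDE** (`2 × 2`, any field): `S ≠ 0 ∧ det S = 0 ↔ ∃ u w, u ≠ 0 ∧ w ≠ 0 ∧ S = u ⊗ w`. [folklore] -/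
theorem ne_zero_and_det_eq_zero_iff {S : Matrix (Fin 2) (Fin 2) K} :
    (S ≠ 0 ∧ S.det = 0) ↔ ∃ u w : Fin 2 → K, u ≠ 0 ∧ w ≠ 0 ∧ S = Matrix.vecMulVec u w := by
  constructor
  · rintro ⟨hS0, hdet⟩
    exact exists_vecMulVec_of_det_eq_zero hS0 hdet
  · rintro ⟨u, w, hu, hw, rfl⟩
    exact ⟨vecMulVec_ne_zero hu hw, det_vecMulVec_fin_two u w⟩

end Summit.HodgeConjecture.HodgeConjecture.Cruxes.HLiu418.K2LiuRankOneTwoByTwo
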